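import Literature.AnabelianGeometry.AbsoluteAnabelian.Coorientations
import Mathlib.Topology.Connected.LocallyConnected
import Mathlib.Data.Finsupp.Ext

/-!
# Proofs for [AbsTopIII] §2: Cor 2.3 (i), second sentence (PROOF-ONLY companion of `Coorientations`)

S. Mochizuki, *Topics in absolute anabelian geometry III*, §2 (bib key `MochizukiAbsTopIII2015`;
locators = kurims manuscript pages, lit key `paper:url-5493eb38cbb7`).  The owner module
`Coorientations.lean` types the second sentence of Cor. 2.3 (i) p. 53 — "there exist precisely two
co-holomorphicizations `𝕏 → 𝕐`, corresponding to the holomorphic and anti-holomorphic local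
isomorphisms" — as the named fact `TwoCoHolomorphicizations`: over any orientation functor `O`
(interface `OrnFunctor`, signs pinned on RC-holomorphic maps), two morphisms of Aut-holomorphic spaces
`U → Y` from a connected open `U` of a connected Riemann surface `X` to a connected Riemann surface `Y`
are co-holomorphic iff they are of the same type (both holomorphic / both anti-holomorphic).

This file PROVES it CONDITIONALLY on the first sentence of Cor. 2.3 (i) (the named fact
`LocalMorphismIsRCHolomorphic` of `AutHolomorphicSpaces.lean`: morphisms of Aut-holomorphic spaces are
RC-holomorphic, being discharged by seat abc-iut-L4-t7):
`twoCoHolomorphicizations_of_localMorphismIsRCHolomorphic`.  The argument is elementary and uses the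
orientation functor only through its axioms:

* `OrnFunctor.not_isHolAt_and_isAntiHolAt` — the two normalisations (`+1` at holomorphic points, `−1` at
  anti-holomorphic points) are incompatible, so no local isomorphism is both at a point;
* `OrnFunctor.isHolAt_iff_of_isCoOriented` — co-oriented RC-holomorphic maps have the same type at
  every point; `OrnFunctor.sameHolType_of_isCoOriented` — hence globally on a connected source (the
  holomorphic locus is clopen); `OrnFunctor.isCoOriented_of_sameHolType` — conversely, maps of the same
  type into a connected target induce the same homomorphism `Orn(Z₁) → Orn(Z₂)` (check on generators);
* `isLocalStructure_setOf_isConnected` — the connected open subsets of a locally connected space (e.g.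
  a Riemann surface, `ChartedSpace.locallyConnectedSpace`) form a local structure in the sense of
  Def. 2.1 (i) (used to specialise `LocalMorphismIsRCHolomorphic` to morphisms; also discharges the
  hypotheses `hX`, `hY` of `AbsTopIII/RemarksArchimedeanLocal.lean`).

HONEST FRAMING: OUR kernel check of an elementary deduction inside a refereed paper; the input
`LocalMorphismIsRCHolomorphic` is a named hypothesis here; nothing bears on [IUTchIII] Cor. 3.12.
-/

noncomputable section

namespace Literature.AnabelianGeometry.AbsoluteAnabelian

universe u

open _root_.TopologicalSpace _root_.Topology _root_.Set
open scoped _root_.Manifold _root_.ContDiff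

/-! ### Connected opens form a local structure -/

/-- In a locally connected space the connected open subsets form a **local structure** (Def. 2.1 (i):
a basis of the topology, closed under passing to connected open subsets).
[cite: MochizukiAbsTopIII2015, Definition 2.1 (i) p.50] -/
theorem isLocalStructure_setOf_isConnected (X : Type u) [TopologicalSpace X] [LocallyConnectedSpace X] :
    IsLocalStructure X {U : Opens X | IsConnected (U : Set X)} where
  isConnected U hU := hU
  isBasis := by
    refine Opens.isBasis_iff_nbhd.mpr ?_
    intro U x hx
    refine ⟨⟨connectedComponentIn (U : Set X) x, U.isOpen.connectedComponentIn⟩, ?_, ?_, ?_⟩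
    · exact ⟨⟨x, mem_connectedComponentIn hx⟩, isPreconnected_connectedComponentIn⟩
    · exact mem_connectedComponentIn hx
    · exact connectedComponentIn_subset _ _
  mem_of_le _ _ V hV _ := hV

/-- A space charted over `ℂ` (e.g. a Riemann surface, or an open subset of one) is locally connected,
so its connected opens form a local structure. [cite: MochizukiAbsTopIII2015, Definition 2.1 (i) p.50] -/
theorem isLocalStructure_setOf_isConnected_of_chartedSpace (X : Type u) [TopologicalSpace X]
    [ChartedSpace ℂ X] : IsLocalStructure X {U : Opens X | IsConnected (U : Set X)} :=
  haveI := ChartedSpace.locallyConnectedSpace ℂ X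
  isLocalStructure_setOf_isConnected X

/-- A morphism of the Aut-holomorphic spaces of Riemann surfaces is RC-holomorphic, GIVEN the first
sentence of Cor. 2.3 (i) (`LocalMorphismIsRCHolomorphic`) — its specialisation to the local structures
of all connected opens. [cite: MochizukiAbsTopIII2015, Corollary 2.3 (i) p.53] -/
theorem IsMorphism.isRCHolomorphic_of (hRC : LocalMorphismIsRCHolomorphic) {X Y : Type}
    [TopologicalSpace X] [T2Space X] [ChartedSpace ℂ X] [IsManifold 𝓘(ℂ, ℂ) ω X]
    [TopologicalSpace Y] [T2Space Y] [ChartedSpace ℂ Y] [IsManifold 𝓘(ℂ, ℂ) ω Y] {φ : X → Y}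
    (hφ : IsMorphism (AutHolStructure.ofCharted X) (AutHolStructure.ofCharted Y) φ) :
    IsRCHolomorphic φ :=
  hRC X Y _ _ (isLocalStructure_setOf_isConnected_of_chartedSpace X)
    (isLocalStructure_setOf_isConnected_of_chartedSpace Y) φ hφ

/-! ### Consequences of the orientation functor's normalisations -/

namespace OrnFunctor

variable {Z₁ Z₂ : Type u} [TopologicalSpace Z₁] [ChartedSpace ℂ Z₁]
  [IsManifold 𝓘(ℂ, ℂ) ω Z₁] [TopologicalSpace Z₂] [ChartedSpace ℂ Z₂] [IsManifold 𝓘(ℂ, ℂ) ω Z₂]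

/-- No local isomorphism of Riemann surfaces is both holomorphic and anti-holomorphic at a point: the
orientation functor would assign it local degree `+1` and `−1` there.
[cite: MochizukiAbsTopIII2015, Definition 2.1 (iii) p.51] -/
theorem not_isHolAt_and_isAntiHolAt (O : OrnFunctor.{u}) (α : Z₁ → Z₂) (hα : IsLocalHomeomorph α) (z : Z₁) :
    ¬ (IsHolAt α z ∧ IsAntiHolAt α z) := by
  rintro ⟨h₁, h₂⟩
  have e := (O.induced_single_of_isHolAt Z₁ Z₂ α hα z h₁).symm.trans
    (O.induced_single_of_isAntiHolAt Z₁ Z₂ α hα z h₂)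
  rcases (Finsupp.single_eq_single_iff _ _ _ _).mp e with ⟨-, h⟩ | ⟨h, -⟩
  · omega
  · omega

/-- The homomorphism induced by an RC-holomorphic local isomorphism on the generator of a point: local
degree `+1` if the map is holomorphic there, `−1` if it is anti-holomorphic there (the two cases being
exclusive). [cite: MochizukiAbsTopIII2015, Definition 2.1 (iii) p.51] -/
theorem induced_single_of_isRCHolomorphic (O : OrnFunctor.{u}) (α : Z₁ → Z₂) (hα : IsLocalHomeomorph α)
    (hrc : IsRCHolomorphic α) (z : Z₁) :
    ∃ ε : ℤ, ((IsHolAt α z ∧ ε = 1) ∨ (IsAntiHolAt α z ∧ ε = -1)) ∧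
      O.induced Z₁ Z₂ α hα (Finsupp.single (ConnectedComponents.mk z) 1) =
        Finsupp.single (ConnectedComponents.mk (α z)) ε := by
  rcases hrc z with h | h
  · exact ⟨1, Or.inl ⟨h, rfl⟩, O.induced_single_of_isHolAt Z₁ Z₂ α hα z h⟩
  · exact ⟨-1, Or.inr ⟨h, rfl⟩, O.induced_single_of_isAntiHolAt Z₁ Z₂ α hα z h⟩

/-- **Co-oriented RC-holomorphic local isomorphisms have the same type at every point.**
[cite: MochizukiAbsTopIII2015, Corollary 2.3 (i) p.53] -/
theorem isHolAt_iff_of_isCoOriented (O : OrnFunctor.{u}) {α β : Z₁ → Z₂} {hα : IsLocalHomeomorph α}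
    {hβ : IsLocalHomeomorph β} (hαrc : IsRCHolomorphic α) (hβrc : IsRCHolomorphic β)
    (h : IsCoOriented O α β hα hβ) (z : Z₁) : IsHolAt α z ↔ IsHolAt β z := by
  obtain ⟨ε, hε, eα⟩ := O.induced_single_of_isRCHolomorphic α hα hαrc z
  obtain ⟨ε', hε', eβ⟩ := O.induced_single_of_isRCHolomorphic β hβ hβrc z
  have heq : Finsupp.single (ConnectedComponents.mk (α z)) ε =
      Finsupp.single (ConnectedComponents.mk (β z)) ε' := by
    rw [← eα, ← eβ]
    exact congrArg (fun f : Orn Z₁ →+ Orn Z₂ => f (Finsupp.single (ConnectedComponents.mk z) 1)) h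
  have hεε' : ε = ε' := by
    rcases (Finsupp.single_eq_single_iff _ _ _ _).mp heq with ⟨-, h⟩ | ⟨h0, h0'⟩
    · exact h
    · rcases hε with ⟨-, rfl⟩ | ⟨-, rfl⟩ <;> simp at h0
  have nα := O.not_isHolAt_and_isAntiHolAt α hα z
  have nβ := O.not_isHolAt_and_isAntiHolAt β hβ z
  rcases hε with ⟨hαz, rfl⟩ | ⟨hαz, rfl⟩ <;> rcases hε' with ⟨hβz, h1⟩ | ⟨hβz, h1⟩
  · exact ⟨fun _ => hβz, fun _ => hαz⟩
  · omega
  · omega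
  · exact ⟨fun h => (nα ⟨h, hαz⟩).elim, fun h => (nβ ⟨h, hβz⟩).elim⟩

/-- **On a connected source, co-oriented RC-holomorphic local isomorphisms are of the same type** (both
holomorphic everywhere or both anti-holomorphic everywhere): the holomorphic locus is open, its
complement — the anti-holomorphic locus — is open, so it is clopen.
[cite: MochizukiAbsTopIII2015, Corollary 2.3 (i) p.53] -/
theorem sameHolType_of_isCoOriented (O : OrnFunctor.{u}) [PreconnectedSpace Z₁] {α β : Z₁ → Z₂} {hα : IsLocalHomeomorph α}
    {hβ : IsLocalHomeomorph β} (hαrc : IsRCHolomorphic α) (hβrc : IsRCHolomorphic β)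
    (h : IsCoOriented O α β hα hβ) : SameHolType α β := by
  have hpt := O.isHolAt_iff_of_isCoOriented hαrc hβrc h
  -- the holomorphic locus of `α` is clopen
  have hopen : IsOpen {z : Z₁ | IsHolAt α z} := isOpen_setOf_eventually_nhds
  have hcompl : {z : Z₁ | IsHolAt α z}ᶜ = {z : Z₁ | IsAntiHolAt α z} := by
    ext z
    simp only [mem_compl_iff, mem_setOf_eq]
    constructor
    · intro hz
      exact (hαrc z).resolve_left hz
    · intro hz hz'
      exact O.not_isHolAt_and_isAntiHolAt α hα z ⟨hz', hz⟩
  have hclosed : IsClosed {z : Z₁ | IsHolAt α z} := by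
    rw [← isOpen_compl_iff, hcompl]
    exact isOpen_setOf_eventually_nhds
  rcases isClopen_iff.mp ⟨hclosed, hopen⟩ with h0 | h1
  · -- no holomorphic point: both maps are anti-holomorphic everywhere
    refine Or.inr ⟨fun z => ?_, fun z => ?_⟩
    · have hz : z ∉ {z : Z₁ | IsHolAt α z} := by rw [h0]; exact notMem_empty z
      exact (hαrc z).resolve_left hz
    · have hz : z ∉ {z : Z₁ | IsHolAt α z} := by rw [h0]; exact notMem_empty z
      exact (hβrc z).resolve_left (fun hb => hz ((hpt z).mpr hb))
  · -- every point is holomorphic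
    refine Or.inl ⟨fun z => ?_, fun z => ?_⟩
    · have hz : z ∈ {z : Z₁ | IsHolAt α z} := by rw [h1]; exact mem_univ z
      exact hz
    · have hz : z ∈ {z : Z₁ | IsHolAt α z} := by rw [h1]; exact mem_univ z
      exact (hpt z).mp hz

/-- **Conversely, on a connected target, local isomorphisms of the same type are co-oriented**: their
induced homomorphisms `Orn(Z₁) → Orn(Z₂)` agree on every generator (local degree `+1`, resp. `−1`, and
`Orn(Z₂) = ℤ`). [cite: MochizukiAbsTopIII2015, Corollary 2.3 (i) p.53] -/
theorem isCoOriented_of_sameHolType (O : OrnFunctor.{u}) [PreconnectedSpace Z₂] {α β : Z₁ → Z₂} (hα : IsLocalHomeomorph α)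
    (hβ : IsLocalHomeomorph β) (h : SameHolType α β) : IsCoOriented O α β hα hβ := by
  have hcc : ∀ y y' : Z₂, ConnectedComponents.mk y = ConnectedComponents.mk y' := fun y y' =>
    ConnectedComponents.coe_eq_coe.mpr (by
      rw [PreconnectedSpace.connectedComponent_eq_univ, PreconnectedSpace.connectedComponent_eq_univ])
  refine Finsupp.addHom_ext' fun c => AddMonoidHom.ext_int ?_
  obtain ⟨z, rfl⟩ := ConnectedComponents.surjective_coe c
  change O.induced Z₁ Z₂ α hα (Finsupp.single (ConnectedComponents.mk z) 1) =
    O.induced Z₁ Z₂ β hβ (Finsupp.single (ConnectedComponents.mk z) 1)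
  rcases h with ⟨hαh, hβh⟩ | ⟨hαa, hβa⟩
  · rw [O.induced_single_of_isHolAt Z₁ Z₂ α hα z (hαh z),
      O.induced_single_of_isHolAt Z₁ Z₂ β hβ z (hβh z), hcc (α z) (β z)]
  · rw [O.induced_single_of_isAntiHolAt Z₁ Z₂ α hα z (hαa z),
      O.induced_single_of_isAntiHolAt Z₁ Z₂ β hβ z (hβa z), hcc (α z) (β z)]

/-- The two together: for RC-holomorphic local isomorphisms between connected Riemann surfaces,
co-oriented ⟺ same type. [cite: MochizukiAbsTopIII2015, Corollary 2.3 (i) p.53] -/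
theorem isCoOriented_iff_sameHolType (O : OrnFunctor.{u}) [PreconnectedSpace Z₁] [PreconnectedSpace Z₂]
    {α β : Z₁ → Z₂}
    (hα : IsLocalHomeomorph α) (hβ : IsLocalHomeomorph β) (hαrc : IsRCHolomorphic α)
    (hβrc : IsRCHolomorphic β) : IsCoOriented O α β hα hβ ↔ SameHolType α β :=
  ⟨O.sameHolType_of_isCoOriented hαrc hβrc, O.isCoOriented_of_sameHolType hα hβ⟩

end OrnFunctor

/-! ### Cor 2.3 (i), second sentence, from the first -/

/-- **Cor. 2.3 (i), second sentence, GIVEN the first**: if morphisms of Aut-holomorphic spaces are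
RC-holomorphic (`LocalMorphismIsRCHolomorphic`, the first sentence of Cor. 2.3 (i)), then for connected
Riemann surfaces `X`, `Y` and a connected open `U ⊆ X`, two morphisms `U → Y` are co-holomorphic
(w.r.t. any orientation functor) iff they are of the same type — i.e. "there exist precisely two
co-holomorphicizations, corresponding to the holomorphic and anti-holomorphic local isomorphisms"
(`TwoCoHolomorphicizations`). [cite: MochizukiAbsTopIII2015, Corollary 2.3 (i) p.53] -/
theorem twoCoHolomorphicizations_of_localMorphismIsRCHolomorphic (hRC : LocalMorphismIsRCHolomorphic) :
    TwoCoHolomorphicizations := by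
  intro O X Y _ _ _ _ _ _ _ _ _ _ U hU φ₁ φ₂ h₁ h₂
  haveI : ConnectedSpace U := isConnected_iff_connectedSpace.mp hU
  have hrc₁ : IsRCHolomorphic φ₁ := IsMorphism.isRCHolomorphic_of hRC h₁
  have hrc₂ : IsRCHolomorphic φ₂ := IsMorphism.isRCHolomorphic_of hRC h₂
  constructor
  · rintro ⟨h₁', h₂', hco⟩
    exact O.sameHolType_of_isCoOriented hrc₁ hrc₂ hco
  · intro hs
    exact ⟨h₁, h₂, O.isCoOriented_of_sameHolType h₁.isLocalHomeomorph h₂.isLocalHomeomorph hs⟩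

end Literature.AnabelianGeometry.AbsoluteAnabelian

end
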